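import Mathlib

/-!
# DualCertificateLawStatic — plan-lens-HodgeAV-dual g9: the STATIC-AWARE (R4) master at h = 14, kernel-checked bookkeeping

Companion to `DUAL-CERT-FAMILY-g9.md` (dual g9; director order R19.399 «(R4) in the Benders master», now with the
H₁-statics of record in the same master).  EVIDENCE-LEVEL only: nothing in this file is a rung or bears on
18881 / H2 / HC_AV / HC_CM / HC / №4 / 26512; it proves no statement about the crux `BlochSeedDiscOne`.
The finite computations of the memo (maximal supports `Y*`, the logic-based Benders runs, cadical verdicts) are NOT
re-checked here; what is checked is the arithmetic and the three LP facts those computations rely on.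

What is checked here (all elementary):
* `newtonE`, `newtonP`, `newtonE_psum`, `newtonP_psum` — the rank-4 NEWTON INSTRUMENT is an identity: for four
  formal roots over any characteristic-zero field, `e₁..e₄` and `p₅..p₈` are the stated rational functions of `p₁..p₄`.
  Hence under (R4) (`λ'_d = p_d(y)`, `d ≤ 7`; `λ'_8 = p_8(y) + |μ|²/140`) the class numbers `λ'_5..λ'_8` are DETERMINED
  by `λ'_1..λ'_4` and `|μ|²`.
* `checkclass1_*` — the check-class-1 ASK (bus l.10263): class `λ' = (4; 2,0,0,0,0,0,0,0)`, `μ = −32i`: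
  `e = (2, 2, 4/3, 2/3)`, predicted `p₅..p₈ = (−4/3, −8/3, −8/3, −16/9)`, required `λ'_8 = 1744/315`; the actual
  `λ'_5 = 0 ≠ −4/3` already contradicts (R4) over every char-0 field (`checkclass1_R4_fails`); independently
  `140 ∤ |μ|² = 1024` and `−32 ∉ 112ℤ` (`checkclass1_mu_not_granular`, cf. `DualCertificateLawNewton.mu_granularity`).
* `target_*` — the ONE LP-alive orbit-level class of g8 (B6h14): `e = (0,8,0,10)` i.e. `y⁴ + 8y² + 10`,
  `p₁..p₈ = (0,−16,0,88,0,−544,0,3472)`, `|μ|² = 56² + 112² = 15680 = 140·112`, `λ'_8 = 3472 + 112 = 3584`: (R4)-consistent.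
* `farkas_cut` — VALIDITY OF THE (A)-CUTS of the static-aware master: if `z ≥ 0` solves `A z = b` and a row price `y`
  has `y ⬝ b < 0`, then some column in the support of `z` has `y ⬝ A_k < 0`; so every design meets `{k | y ⬝ A_k < 0}`
  and the master may learn the clause `⋁_{k : y⬝A_k < 0} x_k` (restricted to the live universe).
* `weak_duality_cut` — VALIDITY OF THE (B)-CUTS: `c_k ≤ y ⬝ A_k (∀ k)`, `z ≥ 0`, `A z = b` ⟹ `c ⬝ z ≤ y ⬝ b`
  (a coverage / budget objective bounded by a dual price is bounded on every design with that support).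
* `cokerPaddingEquiv` — PRESENTATION PADDING: `coker (f ⊕ id_K) ≃ₗ coker f`; the identity live pairs (zero columns)
  change the design and its statics-of-record, not the sheaf — the algebra behind reporting both conventions V1 (pairs of
  record) and V2 (minimal presentations, `--noident`).
* `exists_max_support` — the target fibre `F = {z ≥ 0 | A z = b}` (if non-empty) contains a point whose support is
  EXACTLY the set of alive columns `{k | ∃ w ∈ F, w_k > 0}`; so the maximal support `Y*` is well defined, is attained,
  and every column / orbit outside `Y*` is a unit clause `¬x` for every master keyed by this target (ystar.py).
* `forced_mass` — VALIDITY OF THE FORCED-ORBIT CERTIFICATE (the g9 verdict's LP half): a dual `y` with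
  `-(coef k) ≤ y ⬝ A_k (∀ k)` bounds the mass `coef ⬝ z` of an orbit from below by `-(y ⬝ b)` on EVERY point of the
  fibre; `forced_pair_dead` — the verdict's shape: two forced orbits that no static support contains jointly ⟹ no
  point of the fibre has a static support; `ell_target` — the bound of record at the g8/g9 target,
  `ℓ = 711177740587/1470004106688 > 0` for BOTH orbits A = `N[10I+2l-1|10I+2l-1|10I+2l-1|12I+l-i]`,
  B = `P[10I+2l-1|10I+2l-1|10I+2l-1|12I]` (one dual `y`, exact-checked on all 78 285 columns by `forcedcert.py`);
  the SAT half (residual CNF ∧ x_A ∧ x_B UNSAT) is machine-checked separately in `DualCertificateLawStaticCore.lean`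
  (`static_incompatible_AB`, `bv_decide` on the 604-clause core) — together: DEAD-STATIC, both conventions.
-/

namespace Summit.HodgeConjecture.HodgeConjecture.Cruxes.BlochSeedDiscOne.DualCertificateLawStatic

open Finset Matrix

section Newton

variable {K : Type*} [Field K] [CharZero K]

/-- power sums of four formal roots. -/
def psum (y₁ y₂ y₃ y₄ : K) (d : ℕ) : K := y₁ ^ d + y₂ ^ d + y₃ ^ d + y₄ ^ d

/-- Newton's identities, rank 4: `e₁..e₄` from `p₁..p₄`. -/
def newtonE (p₁ p₂ p₃ p₄ : K) : K × K × K × K :=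
  let e₁ := p₁
  let e₂ := (e₁ * p₁ - p₂) / 2
  let e₃ := (e₂ * p₁ - e₁ * p₂ + p₃) / 3
  let e₄ := (e₃ * p₁ - e₂ * p₂ + e₁ * p₃ - p₄) / 4
  (e₁, e₂, e₃, e₄)

/-- Newton's recursion, rank 4: the predicted `p₅..p₈` from `p₁..p₄`. -/
def newtonP (p₁ p₂ p₃ p₄ : K) : K × K × K × K :=
  let E := newtonE p₁ p₂ p₃ p₄
  let e₁ := E.1
  let e₂ := E.2.1
  let e₃ := E.2.2.1
  let e₄ := E.2.2.2
  let p₅ := e₁ * p₄ - e₂ * p₃ + e₃ * p₂ - e₄ * p₁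
  let p₆ := e₁ * p₅ - e₂ * p₄ + e₃ * p₃ - e₄ * p₂
  let p₇ := e₁ * p₆ - e₂ * p₅ + e₃ * p₄ - e₄ * p₃
  let p₈ := e₁ * p₇ - e₂ * p₆ + e₃ * p₅ - e₄ * p₄
  (p₅, p₆, p₇, p₈)

/-- the instrument is an IDENTITY (elementary symmetric functions of four roots). -/
theorem newtonE_psum (y₁ y₂ y₃ y₄ : K) :
    newtonE (psum y₁ y₂ y₃ y₄ 1) (psum y₁ y₂ y₃ y₄ 2) (psum y₁ y₂ y₃ y₄ 3) (psum y₁ y₂ y₃ y₄ 4)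
      = (y₁ + y₂ + y₃ + y₄,
         y₁*y₂ + y₁*y₃ + y₁*y₄ + y₂*y₃ + y₂*y₄ + y₃*y₄,
         y₁*y₂*y₃ + y₁*y₂*y₄ + y₁*y₃*y₄ + y₂*y₃*y₄,
         y₁*y₂*y₃*y₄) := by
  simp only [newtonE, psum, Prod.mk.injEq]
  refine ⟨by ring, by ring, by ring, by ring⟩

/-- the instrument is an IDENTITY (power sums 5..8 of four roots are determined by power sums 1..4). -/
theorem newtonP_psum (y₁ y₂ y₃ y₄ : K) :
    newtonP (psum y₁ y₂ y₃ y₄ 1) (psum y₁ y₂ y₃ y₄ 2) (psum y₁ y₂ y₃ y₄ 3) (psum y₁ y₂ y₃ y₄ 4)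
      = (psum y₁ y₂ y₃ y₄ 5, psum y₁ y₂ y₃ y₄ 6, psum y₁ y₂ y₃ y₄ 7, psum y₁ y₂ y₃ y₄ 8) := by
  simp only [newtonP, newtonE, psum, Prod.mk.injEq]
  refine ⟨by ring, by ring, by ring, by ring⟩

/-- check-class-1's class `λ' = (4; 2,0,0,0,0,0,0,0)`: `e = (2, 2, 4/3, 2/3)`. -/
theorem checkclass1_E : newtonE (2 : ℚ) 0 0 0 = (2, 2, 4/3, 2/3) := by
  norm_num [newtonE]

/-- … predicted `p₅..p₈ = (−4/3, −8/3, −8/3, −16/9)`. -/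
theorem checkclass1_P : newtonP (2 : ℚ) 0 0 0 = (-4/3, -8/3, -8/3, -16/9) := by
  norm_num [newtonP, newtonE]

/-- … required `λ'_8 = p_8 + |μ|²/140 = −16/9 + 1024/140 = 1744/315` (`μ = −32i`). -/
theorem checkclass1_lam8 : (-16/9 : ℚ) + ((0:ℚ) ^ 2 + (-32) ^ 2) / 140 = 1744 / 315 := by norm_num

/-- (R4) FAILS for that class over every characteristic-zero field: four roots with `p₁ = 2`, `p₂ = p₃ = p₄ = 0`
have `p₅ = −4/3`, whereas the class has `λ'_5 = 0`. -/
theorem checkclass1_R4_fails (y₁ y₂ y₃ y₄ : K) (h1 : psum y₁ y₂ y₃ y₄ 1 = 2) (h2 : psum y₁ y₂ y₃ y₄ 2 = 0)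
    (h3 : psum y₁ y₂ y₃ y₄ 3 = 0) (h4 : psum y₁ y₂ y₃ y₄ 4 = 0) : psum y₁ y₂ y₃ y₄ 5 ≠ 0 := by
  have hid := congrArg Prod.fst (newtonP_psum y₁ y₂ y₃ y₄)
  rw [h1, h2, h3, h4] at hid
  simp only [newtonP, newtonE] at hid
  rw [← hid]
  norm_num

/-- … and independently of (R4)'s Newton part: `140 ∤ |μ|² = 1024` and `Im μ = −32 ∉ 112ℤ`
(the granularity `DualCertificateLawNewton.mu_granularity` of orbit-constant integer designs at h = 14). -/
theorem checkclass1_mu_not_granular : ¬ (140:ℤ) ∣ 0 ^ 2 + (-32) ^ 2 ∧ ¬ (112:ℤ) ∣ -32 := by decide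

/-- the g8/g9 TARGET class (B6h14): `e = (0, 8, 0, 10)` from `p₁..p₄ = (0, −16, 0, 88)` … -/
theorem target_E : newtonE (0 : ℚ) (-16) 0 88 = (0, 8, 0, 10) := by
  norm_num [newtonE]

/-- … predicted `p₅..p₈ = (0, −544, 0, 3472)` = the class's `λ'_5..λ'_7` and `λ'_8 − |μ|²/140` … -/
theorem target_P : newtonP (0 : ℚ) (-16) 0 88 = (0, -544, 0, 3472) := by
  norm_num [newtonP, newtonE]

/-- … with `|μ|² = 56² + 112² = 15680 = 140 · 112`, `λ'_8 = 3472 + 112 = 3584`, `Re μ ∈ 28ℤ`, `Im μ ∈ 112ℤ`. -/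
theorem target_lam8 : (56:ℤ) ^ 2 + 112 ^ 2 = 140 * 112 ∧ (3472:ℤ) + 112 = 3584 ∧ (28:ℤ) ∣ 56 ∧ (112:ℤ) ∣ 112 := by
  decide

/-- the target quartic `y⁴ + 8y² + 10` is `(y² + 4)² − 6`: its roots `±√(−4 ± √6)` are all non-real
(`−4 ± √6 < 0`), so the four twisted roots `x = 14 + y` are non-real — recorded for the critics' «real-rootedness» reading. -/
theorem target_quartic_no_real_root (y : ℝ) : y ^ 4 + 8 * y ^ 2 + 10 ≠ 0 := by
  nlinarith [sq_nonneg y, sq_nonneg (y ^ 2)]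

end Newton

section Cuts

/-- support of a sum of non-negative vectors is the union of the supports. -/
theorem pos_add_iff_of_nonneg {a b : ℚ} (ha : 0 ≤ a) (hb : 0 ≤ b) : 0 < a + b ↔ 0 < a ∨ 0 < b := by
  constructor
  · intro h
    by_contra hcon
    push Not at hcon
    linarith [hcon.1, hcon.2]
  · rintro (h | h) <;> linarith

/-- the pairing identity behind both cut families: `y ⬝ (A z) = Σ_k (y ⬝ A_k) z_k`. -/
theorem dot_mulVec_eq_sum_cols {m n : ℕ} (A : Matrix (Fin m) (Fin n) ℚ) (y : Fin m → ℚ) (z : Fin n → ℚ) :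
    y ⬝ᵥ (A *ᵥ z) = ∑ k, (y ⬝ᵥ fun i => A i k) * z k := by
  simp only [dotProduct, Matrix.mulVec, Finset.mul_sum, Finset.sum_mul]
  rw [Finset.sum_comm]
  exact Finset.sum_congr rfl fun k _ => Finset.sum_congr rfl fun i _ => by ring

/-- (A)-CUT VALIDITY (Farkas direction).  `z ≥ 0`, `A z = b`, `y ⬝ b < 0` ⟹ some support column of `z` has
negative price.  Used as: the target LP restricted to the columns of a master support `Y` is infeasible with Farkas
certificate `y` (`y ⬝ A_k ≥ 0 ∀ k ∈ cols(Y)`, `y ⬝ b < 0`) ⟹ every design (any support) uses a column of negative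
price ⟹ clause `⋁ {x_k | y ⬝ A_k < 0}` — which excludes `Y` and every support inside `{k | y ⬝ A_k ≥ 0}`. -/
theorem farkas_cut {m n : ℕ} (A : Matrix (Fin m) (Fin n) ℚ) (b y : Fin m → ℚ) (z : Fin n → ℚ)
    (hz : ∀ k, 0 ≤ z k) (hAz : A *ᵥ z = b) (hyb : y ⬝ᵥ b < 0) :
    ∃ k, 0 < z k ∧ (y ⬝ᵥ fun i => A i k) < 0 := by
  by_contra hcon
  push Not at hcon
  have key : y ⬝ᵥ b = ∑ k, (y ⬝ᵥ fun i => A i k) * z k := by rw [← hAz, dot_mulVec_eq_sum_cols]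
  have hnn : 0 ≤ ∑ k, (y ⬝ᵥ fun i => A i k) * z k := by
    refine Finset.sum_nonneg fun k _ => ?_
    rcases (hz k).eq_or_lt with h | h
    · rw [← h]; simp
    · exact mul_nonneg (hcon k h) h.le
  linarith

/-- (B)-CUT VALIDITY (weak duality).  `c_k ≤ y ⬝ A_k (∀ k)`, `z ≥ 0`, `A z = b` ⟹ `c ⬝ z ≤ y ⬝ b`. -/
theorem weak_duality_cut {m n : ℕ} (A : Matrix (Fin m) (Fin n) ℚ) (b y : Fin m → ℚ) (c z : Fin n → ℚ)
    (hz : ∀ k, 0 ≤ z k) (hAz : A *ᵥ z = b) (hc : ∀ k, c k ≤ y ⬝ᵥ fun i => A i k) :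
    c ⬝ᵥ z ≤ y ⬝ᵥ b := by
  have key : y ⬝ᵥ b = ∑ k, (y ⬝ᵥ fun i => A i k) * z k := by rw [← hAz, dot_mulVec_eq_sum_cols]
  rw [key, dotProduct]
  exact Finset.sum_le_sum fun k _ => mul_le_mul_of_nonneg_right (hc k) (hz k)

/-- MAXIMAL SUPPORT of the target fibre.  If `F = {z ≥ 0 | A z = b}` is non-empty it contains a point `z⋆` whose
support is exactly the set of ALIVE columns `{k | ∃ w ∈ F, 0 < w_k}` (average of one witness per alive column).
Consequently `Y* := supp z⋆` is the maximum support over `F`, and `k ∉ Y*` ⟹ `w_k = 0` for every `w ∈ F`. -/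
theorem exists_max_support {m n : ℕ} (A : Matrix (Fin m) (Fin n) ℚ) (b : Fin m → ℚ)
    (z₀ : Fin n → ℚ) (hz₀ : ∀ k, 0 ≤ z₀ k) (hAz₀ : A *ᵥ z₀ = b) :
    ∃ z : Fin n → ℚ, (∀ k, 0 ≤ z k) ∧ A *ᵥ z = b ∧
      ∀ k, (0 < z k ↔ ∃ w : Fin n → ℚ, (∀ j, 0 ≤ w j) ∧ A *ᵥ w = b ∧ 0 < w k) := by
  classical
  let W : Fin n → (Fin n → ℚ) := fun k =>
    if h : ∃ w : Fin n → ℚ, (∀ j, 0 ≤ w j) ∧ A *ᵥ w = b ∧ 0 < w k then h.choose else z₀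
  have hW : ∀ k, (∀ j, 0 ≤ W k j) ∧ A *ᵥ W k = b := by
    intro k
    by_cases h : ∃ w : Fin n → ℚ, (∀ j, 0 ≤ w j) ∧ A *ᵥ w = b ∧ 0 < w k
    · simp only [W, dif_pos h]; exact ⟨h.choose_spec.1, h.choose_spec.2.1⟩
    · simp only [W, dif_neg h]; exact ⟨hz₀, hAz₀⟩
  have hWpos : ∀ k, (∃ w : Fin n → ℚ, (∀ j, 0 ≤ w j) ∧ A *ᵥ w = b ∧ 0 < w k) → 0 < W k k := by
    intro k h; simp only [W, dif_pos h]; exact h.choose_spec.2.2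
  set c : ℚ := 1 / ((n:ℚ) + 1) with hc_def
  have hc : 0 < c := by positivity
  let z : Fin n → ℚ := fun j => c * (z₀ j + ∑ k, W k j)
  have hz_nonneg : ∀ j, 0 ≤ z j := fun j =>
    mul_nonneg hc.le (add_nonneg (hz₀ j) (Finset.sum_nonneg fun k _ => (hW k).1 j))
  have hz_feas : A *ᵥ z = b := by
    have h1 : z = c • (z₀ + ∑ k, W k) := by
      ext j; simp [z, Finset.sum_apply, smul_eq_mul]
    have h2 : A *ᵥ (∑ k, W k) = ∑ _k : Fin n, b := by
      rw [← Matrix.mulVecLin_apply, map_sum]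
      exact Finset.sum_congr rfl fun k _ => by rw [Matrix.mulVecLin_apply, (hW k).2]
    rw [h1, Matrix.mulVec_smul, Matrix.mulVec_add, hAz₀, h2]
    ext i
    simp only [Pi.smul_apply, Pi.add_apply, Finset.sum_const, Finset.card_univ, Fintype.card_fin,
      smul_eq_mul, hc_def]
    simp only [nsmul_eq_mul]
    field_simp
    ring
  refine ⟨z, hz_nonneg, hz_feas, fun k => ⟨fun hk => ⟨z, hz_nonneg, hz_feas, hk⟩, fun h => ?_⟩⟩
  have h1 : 0 < W k k := hWpos k h
  have h2 : W k k ≤ ∑ k', W k' k := by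
    have := Finset.single_le_sum (f := fun k' => W k' k) (fun k' _ => (hW k').1 k) (Finset.mem_univ k)
    simpa [Finset.sum_apply] using this
  have h3 : 0 < z₀ k + ∑ k', W k' k := by linarith [hz₀ k]
  show 0 < c * (z₀ k + ∑ k', W k' k)
  exact mul_pos hc h3

/-- corollary used by ystar.py / r4static.py `--dead`: a column outside the maximal support is zero on the whole fibre. -/
theorem dead_col_zero {m n : ℕ} (A : Matrix (Fin m) (Fin n) ℚ) (b : Fin m → ℚ) (zs : Fin n → ℚ)
    (hmax : ∀ k, (0 < zs k ↔ ∃ w : Fin n → ℚ, (∀ j, 0 ≤ w j) ∧ A *ᵥ w = b ∧ 0 < w k))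
    (k : Fin n) (hk : zs k ≤ 0) (w : Fin n → ℚ) (hw : ∀ j, 0 ≤ w j) (hAw : A *ᵥ w = b) : w k = 0 := by
  by_contra hne
  have hpos : 0 < w k := lt_of_le_of_ne (hw k) (Ne.symm hne)
  have := (hmax k).mpr ⟨w, hw, hAw, hpos⟩
  linarith

end Cuts

section Forced

/-- FORCED-ORBIT VALIDITY (the g9 certificate).  If `y` is dual-feasible for the objective «minus the mass of orbit `o`»,
i.e. `-(coef k) ≤ y ⬝ A_k` for every column `k` (`coef k ≥ 0` = the mass orbit `o` receives from one unit of column `k`),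
then EVERY point `z ≥ 0`, `A z = b` of the target fibre carries `mass_o(z) = coef ⬝ z ≥ -(y ⬝ b)`.  With `-(y ⬝ b) > 0`
the orbit is present in every design carrying the class («LP-forced»), in both conventions (zero columns have
`y ⬝ A_k = 0 ≥ -(coef k)`, so they are covered by the same certificate). -/
theorem forced_mass {m n : ℕ} (A : Matrix (Fin m) (Fin n) ℚ) (b y : Fin m → ℚ) (coef z : Fin n → ℚ)
    (hz : ∀ k, 0 ≤ z k) (hAz : A *ᵥ z = b) (hy : ∀ k, -(coef k) ≤ y ⬝ᵥ fun i => A i k) :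
    -(y ⬝ᵥ b) ≤ coef ⬝ᵥ z := by
  have h := weak_duality_cut A b y (fun k => -(coef k)) z hz hAz hy
  have hneg : (fun k => -(coef k)) ⬝ᵥ z = -(coef ⬝ᵥ z) := by
    simp only [dotProduct, neg_mul, Finset.sum_neg_distrib]
  linarith [hneg ▸ h]

/-- THE SHAPE OF THE VERDICT.  If two orbits `A`, `B` are forced (positive mass at every point of the fibre `F`) and no
static support contains both, then no point of `F` has a static support. -/
theorem forced_pair_dead {ι P : Type*} (F : Set P) (mass : ι → P → ℚ) (Static : Set (Set ι)) (A B : ι)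
    (hA : ∀ z ∈ F, 0 < mass A z) (hB : ∀ z ∈ F, 0 < mass B z)
    (hAB : ∀ S ∈ Static, ¬ (A ∈ S ∧ B ∈ S)) :
    ∀ z ∈ F, {o | 0 < mass o z} ∉ Static := by
  intro z hz hS
  exact hAB _ hS ⟨hA z hz, hB z hz⟩

/-- The universal valid inequality of record on B6h14 (R = 4): with the optimal dual `y` of `forcedcert.py` (entries on the
rows λ'_1..λ'_8, Re μ, Im μ, budget; the 13 (H1) rows have right-hand side 0 and drop out of `y ⬝ b`),
`ℓ(λ', μ) := -(Σ_d yλ_d·λ'_d + yRe·Re μ + yIm·Im μ + 4·ybud)` bounds the mass of EACH of the two orbits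
A = `N[10I+2l-1|10I+2l-1|10I+2l-1|12I+l-i]`, B = `P[10I+2l-1|10I+2l-1|10I+2l-1|12I]` from below in every design of class (λ', μ).
At the g8/g9 target λ' = (0,−16,0,88,0,−544,0,3584), μ = 56 + 112 i it equals 711177740587/1470004106688 ≈ 0.4838 > 0. -/
theorem ell_target :
    -((675/964 : ℚ) * 0 + (2925/15424) * (-16) + (549/30848) * 0 + (-13552041108485/290683888994304) * 88
      + (-21871777957591/872051666982912) * 0 + (-18515231639675/3488206667931648) * (-544)
      + (-902160860981/1744103333965824) * 0 + (-134566928863/6976413335863296) * 3584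
      + (-100038479610463/5668335835388928) * 56 + (-1286611225067/54503229186432) * 112
      + 4 * (2012956997/1078332328)) = 711177740587/1470004106688 ∧
    (0 : ℚ) < 711177740587/1470004106688 := by
  constructor <;> norm_num

/-- Control: the hub-only design (4 copies of `N[14I|14I|14I|14I]`, class λ' = 0, μ = 0) has `ℓ = -2012956997/269583082 < 0`
(consistent: it contains neither A nor B). -/
theorem ell_hub_only : -(4 * (2012956997/1078332328 : ℚ)) = -2012956997/269583082 ∧ (-2012956997/269583082 : ℚ) < 0 := by
  constructor <;> norm_num

end Forced

section Padding

/-! ### Presentation padding (the V1 ∕ V2 convention of the memo)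
The flow model's «identity live pairs» `P[w] → N[w]` are ZERO columns: a cancelling unit block.  Adding one to a two-term
complex changes the DESIGN (the presentation, hence its support and its statics-of-record) but not the cokernel sheaf.
V1 = live pairs of record (both ends count as support), V2 = minimal presentations (`--noident`).  The algebra: -/

variable {R : Type*} [Ring R] {M N K : Type*} [AddCommGroup M] [AddCommGroup N] [AddCommGroup K]
  [Module R M] [Module R N] [Module R K]

/-- range of a padded presentation map `f ⊕ id_K`. -/
theorem range_prodMap_id (f : M →ₗ[R] N) :
    LinearMap.range (f.prodMap (LinearMap.id : K →ₗ[R] K)) = (LinearMap.range f).prod ⊤ := by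
  rw [LinearMap.range_prodMap, LinearMap.range_id]

/-- PRESENTATION PADDING: `coker (f ⊕ id_K) ≃ coker f` — a cancelling unit block does not change the cokernel. -/
noncomputable def cokerPaddingEquiv (f : M →ₗ[R] N) :
    ((N × K) ⧸ LinearMap.range (f.prodMap (LinearMap.id : K →ₗ[R] K))) ≃ₗ[R] (N ⧸ LinearMap.range f) :=
  (Submodule.quotEquivOfEq _ _ (by
      rw [range_prodMap_id, LinearMap.ker_comp, Submodule.ker_mkQ, Submodule.comap_fst])).trans
    (LinearMap.quotKerEquivOfSurjective ((LinearMap.range f).mkQ.comp (LinearMap.fst R N K))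
      ((Submodule.mkQ_surjective _).comp Prod.fst_surjective))

end Padding

end Summit.HodgeConjecture.HodgeConjecture.Cruxes.BlochSeedDiscOne.DualCertificateLawStatic
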